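import Literature.AlgebraicGeometry.Villamayor2007.UniversalElimination
import Mathlib.Algebra.Polynomial.Degree.Support
import HarnessLib

/-!
# Villamayor 2007, §2.1 / Def. 1.42 (one polynomial) / Def. 4.10: Rees algebras of ideal families, the
# SPECIALIZATION `R_b → S` of the universal algebra, and the ELIMINATION ALGEBRA `R̄_f = ⊕ I_r W^r ⊂ S[W]`
# of a monic polynomial — real definitions

O. E. Villamayor U., *Hypersurface singularities in positive characteristic*, Adv. Math. **213** (2007)
687–733 = arXiv:math/0606796 [Villamayor2007]; locators «p00NN Lnn» = chunk · line of the held arXiv text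
(`lit read paper:arxiv-math_0606796`; chunks p0006–p0015, p0020–p0023 re-read before typing). Sibling of
`UniversalElimination.lean` (the universal algebra `R̄_b = univElimOne`, its pieces `univElimPiece`, the
universal polynomial `univMonic`). Campaign `res-hironaka` (D-0089), ladder rung LIT-6. VOCABULARY file: real
definitions, elementary API PROVED, NO named facts; nothing of Hironaka's 2017 manuscript is referred to.

## What is typed, and how

* **§2.1 p0015 L13–L23: the graded subring of an ideal family.** «Fix a noetherian ring `B`, and a sequence of
  ideals `{I_k}`, `k ≥ 0`, which fulfill the conditions: i) `I_0 = B`, and ii) `I_k · I_s ⊂ I_{k+s}`. This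
  defines a graded subring `⊕ I_k W^k` of the polynomial ring `B[W]`». Typed for ANY family `I : ℕ → Ideal B`
  as `reesOfFamily I := Algebra.adjoin B {c W^k ; c ∈ I_k}` (the `B`-subalgebra generated by the ideals placed
  in their degrees); PROVED `mem_reesOfFamily_iff`: under i) and ii) an element of `B[W]` lies in it iff its
  `W^k`-coefficient lies in `I_k` for every `k` — i.e. it IS `⊕ I_k W^k`. (Noetherianity / finite generation,
  which make it a «Rees algebra» in the source's sense, are not part of the definition and not proved.) For a
  single ideal's powers this is Mathlib's `reesAlgebra`; not restated.
* **§1.5 p0007 L15–L16, L63–L66 and Def. 1.42 p0014 L18–L28 (one block, `r = 1`): specialization.** «every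
  monic polynomial of degree `b`, say `f(Z) = Z^b + a₁Z^{b−1} + … + a_b ∈ S[Z]`, over a `k`-algebra `S`, is
  obtained from `F_b(Z) ∈ R_b[Z]` by a unique morphism `R_b → S`» … «Here `R_b` is mapped to `S`, so that
  `F_b(Z)` defines `f(Z)`». With `R_b = k[s_{b,1},…,s_{b,b}]` FREE on the elementary symmetric polynomials
  (Mathlib `MvPolynomial.esymmAlgEquiv`) the morphism is `specialize a : symmetricSubalgebra (Fin b) k →ₐ[k] S`,
  `s_{b,i} ↦ (−1)^i a_i` (since `F_b = Z^b − s_{b,1}Z^{b−1} + … + (−1)^b s_{b,b}`, p0007 L13); coefficients are a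
  vector `a : Fin b → S` (`a i = a_{i+1}`), the polynomial is `monicOf a`. PROVED: `specialize_esymm`, the
  coefficients of `F_b` are symmetric (`isSymmetric_coeff_univMonic`) and `specialize` SENDS THEM TO THOSE OF `f`
  (`specialize_coeff_univMonic` — the printed «`F_b(Z)` defines `f(Z)`»), and compatibility with change of the
  base ring (`specialize_comp`, p0006 L67–L68 / p0008 L10–L12).
* **§1.5 p0007 L65–L83 and Def. 1.42 (1.42.2): THE ELIMINATION ALGEBRA OF `f`.** «an homogenous element `H` of
  degree, say `r`, in `R̄_b`, maps to an element, say `h`, in `S` … we assign to `H` the element `h·W^r` in the ring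
  `S[W]` … the `S` subalgebra of `S[W]` generated by `{h₁·W^{r₁},…,h_s·W^{r_s}}` … This is a Rees algebra, a direct
  sum of ideals in `S`, say `⊕_{r≥0} I_r W^r`. Now for each index `r`, the ideal `I_r` is generated by polynomials on
  the coefficients of `f(Z)`»: `elimGen a r` = the images of the degree-`r` piece `[R̄_b]_r`, `elimIdeal a r = I_r :=
  Ideal.span (elimGen a r)`, `elimAlgebra a := reesOfFamily (elimIdeal a) ⊂ S[W]` (Def. 1.42 (1.42.2)
  `R̄_{f} ⊂ S[W]` for `r = 1`). PROVED: `I_0 = S` (`elimIdeal_zero`), `I_m I_n ⊆ I_{m+n}` (`elimIdeal_mul_le`), hence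
  `mem_elimAlgebra_iff` (`q ∈ R̄_f ↔ ∀ r, coeff_r q ∈ I_r` — the printed «direct sum of ideals»), functoriality in
  `S` (`elimIdeal_map`), and that the polynomial Δ-invariant `∏_{i≠j}(Y_i − Y_j)` supplies a member of
  `I_{b(b−1)}` (`specialize_prod_sub_mem_elimIdeal`, the discriminant up to sign, p0006 L22–L23).
* **Def. 4.10 p0022 L46–L71 (the `r = 1` sub-family only).** For an algebra given near a point through its
  contracted degree pieces `I_{(c)} = I_c ∩ S[Z]` («`f_{c_i}(Z) ∈ I_{(c_i)}` monic of degree `c_i` in `S[Z]`»),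
  `elimAlgebraOneGen I := ⨆_{c, f ∈ I_{(c)} monic of degree c} R̄_f ⊂ S[W]` — the subalgebra generated by the
  ONE-polynomial elimination algebras. The printed `R_𝒢` is «the smallest subalgebra of `S[W]` containing all
  (elimination) algebras `R̄_{f_{c₁},f_{c₂},…,f_{c_r}}`, for all choices of `r`», and `R̄_{f_{c₁},…,f_{c_r}} ⊇ R̄_{f_{c_i}}`
  (p0022 L64–L66), so `elimAlgebraOneGen I ⊆ R_𝒢`; EQUALITY IS NOT CLAIMED and `R_𝒢` itself is not typed:
  -- TODO(general form): Def. 1.42 / Def. 4.10 for `r ≥ 2` blocks need the specialization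
  `T = k[s^{(1)},…,s^{(r)}] = k[Y]^{𝕊_{c₁}×⋯×𝕊_{c_r}} → S`, i.e. the fundamental theorem for Young-subgroup
  invariants (`T ≅ ⊗_i k[s^{(i)}]`), which Mathlib does not have; the universal side `univElim blk` IS typed.

Deliberately NOT typed (theorems of the source; named facts only on a consumer's request): Thm. 1.16
(purely ramified locus = `V(I_r, r ≥ 1)`; multiplicity `b` ⇒ `ν_S(I_r) ≥ r`), Thm. 4.11 / 4.13 (`R_𝒢 ⊂ 𝒢̄ ∩ S[W]`,
integrality, `Sing`), BV2010 Thm. 1.6 (stability under transformations); transversality / `β`-admissibility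
hypotheses of Def. 4.10 are hypotheses of those theorems, not data of the algebra, and are not encoded.

## References

* O. E. Villamayor U., Adv. Math. 213 (2007) 687–733 = arXiv:math/0606796: §1.5, Def. 1.42, §2.1, Def. 4.10.
  [Villamayor2007]
* A. Bravo, O. E. Villamayor U., Adv. Math. 224 (2010) 1349–1418 = arXiv:0807.4308, §2.7–§2.9.
  [BravoVillamayor2010]
-/

noncomputable section

open scoped Polynomial

namespace Literature.AlgebraicGeometry.Villamayor2007

open MvPolynomial

universe u v w

/-! ## §2.1: the graded subring `⊕ I_k W^k ⊂ B[W]` of a family of ideals -/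

section Rees

variable {B : Type u} [CommRing B]

variable (B) in
/-- **The graded subring of an ideal family** [Villamayor 2007, §2.1 p0015 L13–L23]: «Fix a noetherian ring `B`,
and a sequence of ideals `{I_k}`, `k ≥ 0` … This defines a graded subring `⊕_{k} I_k · W^k` of the polynomial ring
`B[W]`»: the `B`-subalgebra of `B[W]` generated by the monomials `c W^k`, `c ∈ I_k`. Under the printed conditions
i) `I_0 = B`, ii) `I_k I_s ⊂ I_{k+s}` its elements are exactly the polynomials with `coeff_k ∈ I_k`
(`mem_reesOfFamily_iff`). (The source calls it a «Rees algebra» when it is a finitely generated `B`-algebra —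
not part of this definition.) [cite: Villamayor2007, §2.1] -/
def reesOfFamily (I : ℕ → Ideal B) : Subalgebra B B[X] :=
  Algebra.adjoin B {g | ∃ (n : ℕ) (c : B), c ∈ I n ∧ g = Polynomial.monomial n c}

/-- Generators: `c W^n ∈ ⊕ I_k W^k` for `c ∈ I_n`. [cite: Villamayor2007, §2.1] -/
theorem monomial_mem_reesOfFamily {I : ℕ → Ideal B} {n : ℕ} {c : B} (hc : c ∈ I n) :
    Polynomial.monomial n c ∈ reesOfFamily B I :=
  Algebra.subset_adjoin ⟨n, c, hc, rfl⟩

/-- The «direct sum» description [Villamayor 2007, §2.1 p0015 L13–L23]: if i) `I_0 = B` and ii)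
`I_k · I_s ⊂ I_{k+s}`, then `q ∈ ⊕ I_k W^k` iff every coefficient `coeff_k q` lies in `I_k`.
[cite: Villamayor2007, §2.1] -/
theorem mem_reesOfFamily_iff {I : ℕ → Ideal B} (h0 : I 0 = ⊤) (hmul : ∀ m n, I m * I n ≤ I (m + n))
    {q : B[X]} : q ∈ reesOfFamily B I ↔ ∀ n, q.coeff n ∈ I n := by
  constructor
  · intro hq
    induction hq using Algebra.adjoin_induction with
    | mem g hg =>
      obtain ⟨m, c, hc, rfl⟩ := hg
      intro n
      rw [Polynomial.coeff_monomial]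
      split_ifs with h
      · subst h; exact hc
      · exact zero_mem _
    | algebraMap r =>
      intro n
      rw [Polynomial.algebraMap_apply, Polynomial.coeff_C]
      split_ifs with h
      · subst h; rw [h0]; exact Submodule.mem_top
      · exact zero_mem _
    | add x y _ _ hx hy => intro n; rw [Polynomial.coeff_add]; exact add_mem (hx n) (hy n)
    | mul x y _ _ hx hy =>
      intro n
      rw [Polynomial.coeff_mul]
      refine sum_mem fun ij hij => ?_
      have h := Finset.mem_antidiagonal.mp hij
      rw [← h]
      exact hmul _ _ (Ideal.mul_mem_mul (hx ij.1) (hy ij.2))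
  · intro hq
    rw [Polynomial.as_sum_support q]
    refine Subalgebra.sum_mem _ fun n _ => ?_
    -- `coeff_n q ∈ I_n`, and `c ↦ c W^n` maps `I_n` into the subalgebra
    have key : ∀ c ∈ I n, Polynomial.monomial n c ∈ reesOfFamily B I := fun c hc =>
      monomial_mem_reesOfFamily hc
    exact key _ (hq n)

/-- Monotonicity in the family. [cite: Villamayor2007, §2.1] -/
theorem reesOfFamily_mono {I J : ℕ → Ideal B} (h : ∀ n, I n ≤ J n) : reesOfFamily B I ≤ reesOfFamily B J :=
  Algebra.adjoin_mono fun _ ⟨n, c, hc, hg⟩ => ⟨n, c, h n hc, hg⟩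

end Rees

/-! ## Def. 1.42 (one block): the specialization `R_b → S` attached to a monic polynomial -/

section Specialize

variable (k : Type v) [CommRing k] {S : Type w} [CommRing S] [Algebra k S] {b : ℕ}

/-- **The monic polynomial with coefficient vector `a`** [Villamayor 2007, §1.5 p0007 L15]: «`f(Z) = Z^b +
a₁Z^{b−1} + … + a_b ∈ S[Z]`», with `a : Fin b → S`, `a i = a_{i+1}` (so `a i` is the coefficient of `Z^{b−1−i}`).
[cite: Villamayor2007, §1.5] -/
def monicOf (a : Fin b → S) : S[X] :=
  Polynomial.X ^ b + ∑ i : Fin b, Polynomial.C (a i) * Polynomial.X ^ (b - 1 - (i : ℕ))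

/-- **Specialization «from universal to concrete»** [Villamayor 2007, §1.5 p0007 L15–L16, L63–L64; Def. 1.42
p0014 L25–L28 «`f_i(Z)` is obtained from `F_{c_i}(Z)` by the change of base rings `π : k[s^{(i)}_1,…,s^{(i)}_{c_i}]
→ S` defined by setting `π(s^{(i)}_j) = a^{(i)}_j`»; p0009 L44–L45 «mapping `(−1)^i s_{b,i}` to `c_i`»]: the unique
`k`-algebra map `R_b = k[Y₁,…,Y_b]^{𝕊_b} → S` with `s_{b,i} ↦ (−1)^i a_i`, so that `F_b(Z) = Z^b − s_{b,1}Z^{b−1} +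
… ↦ f(Z) = Z^b + a₁Z^{b−1} + …` (`specialize_coeff_univMonic`). Built from Mathlib's fundamental theorem of
symmetric polynomials `MvPolynomial.esymmAlgEquiv` (`R_b` is free on `s_{b,1},…,s_{b,b}`).
[cite: Villamayor2007, Def. 1.42] -/
def specialize (a : Fin b → S) : symmetricSubalgebra (Fin b) k →ₐ[k] S :=
  (MvPolynomial.aeval fun i : Fin b => (-1 : S) ^ ((i : ℕ) + 1) * a i).comp
    (esymmAlgEquiv (Fin b) k (Fintype.card_fin b)).symm.toAlgHom

/-- `specialize a (s_{b,i+1}) = (−1)^{i+1} a_i` — the defining values (p0009 L44–L45). [cite: Villamayor2007, Def. 1.42] -/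
theorem specialize_esymm (a : Fin b → S) (i : Fin b) :
    specialize k a ⟨esymm (Fin b) k ((i : ℕ) + 1), esymm_isSymmetric _ _ _⟩ = (-1) ^ ((i : ℕ) + 1) * a i := by
  simp [specialize, esymmAlgEquiv_symm_apply]

variable {k}

/-- The coefficients of the universal polynomial `F_b(Z)` are symmetric (they are `± s_{b,i}`, p0007 L13); stated
for any finite index type. [cite: Villamayor2007, §1.5] -/
theorem isSymmetric_coeff_univMonic {ι : Type u} [Fintype ι] (j : ℕ) :
    ((univMonic ι k).coeff j).IsSymmetric := by
  intro σ
  have hmap : Polynomial.map (rename σ).toRingHom (univMonic ι k) = univMonic ι k := by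
    rw [univMonic, Polynomial.map_prod]
    simp only [AlgHom.toRingHom_eq_coe, Polynomial.map_sub, Polynomial.map_X, Polynomial.map_C,
      RingHom.coe_coe, rename_X]
    exact Fintype.prod_equiv σ (fun i => Polynomial.X - Polynomial.C (X (σ i)))
      (fun i => Polynomial.X - Polynomial.C (X i)) fun _ => rfl
  have h := congrArg (fun q => q.coeff j) hmap
  simpa only [Polynomial.coeff_map, AlgHom.toRingHom_eq_coe, RingHom.coe_coe] using h

/-- Coefficients of `monicOf a`: `coeff_{b} = 1`, `coeff_{b−1−i} = a_i`. [cite: Villamayor2007, §1.5] -/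
theorem coeff_monicOf_of_lt (a : Fin b → S) (i : Fin b) :
    (monicOf a).coeff (b - 1 - (i : ℕ)) = a i := by
  classical
  have hi : (i : ℕ) < b := i.2
  rw [monicOf, Polynomial.coeff_add, Polynomial.coeff_X_pow, if_neg (by omega), zero_add,
    Polynomial.finsetSum_coeff]
  simp only [Polynomial.coeff_C_mul, Polynomial.coeff_X_pow]
  rw [Finset.sum_eq_single i]
  · simp
  · intro j _ hji
    rw [if_neg]
    · simp
    · intro h
      apply hji
      ext
      have := j.2
      omega
  · simp

/-- `coeff_b (monicOf a) = 1`. [cite: Villamayor2007, §1.5] -/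
theorem coeff_monicOf_self (a : Fin b → S) : (monicOf a).coeff b = 1 := by
  classical
  rw [monicOf, Polynomial.coeff_add, Polynomial.coeff_X_pow, if_pos rfl, Polynomial.finsetSum_coeff]
  simp only [Polynomial.coeff_C_mul, Polynomial.coeff_X_pow]
  rw [Finset.sum_eq_zero]
  · simp
  · intro j _
    rw [if_neg]
    · simp
    · have := j.2; omega

/-- **`F_b(Z)` defines `f(Z)`** [Villamayor 2007, §1.5 p0007 L15–L16, L63–L64]: the specialization `R_b → S`
attached to `a` sends the (symmetric) coefficient of `Z^{b−1−i}` in `F_b(Z) = Z^b − s_{b,1}Z^{b−1} + … +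
(−1)^b s_{b,b}` to `a_i`, the coefficient of `Z^{b−1−i}` in `f(Z) = monicOf a`. [cite: Villamayor2007, §1.5] -/
theorem specialize_coeff_univMonic (a : Fin b → S) (i : Fin b) :
    specialize k a ⟨(univMonic (Fin b) k).coeff (b - 1 - (i : ℕ)), isSymmetric_coeff_univMonic _⟩ =
      (monicOf a).coeff (b - 1 - (i : ℕ)) := by
  have hi : (i : ℕ) < b := i.2
  have hcard : Fintype.card (Fin b) - (b - 1 - (i : ℕ)) = (i : ℕ) + 1 := by
    rw [Fintype.card_fin]; omega
  have hc : (univMonic (Fin b) k).coeff (b - 1 - (i : ℕ)) =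
      (-1) ^ ((i : ℕ) + 1) * esymm (Fin b) k ((i : ℕ) + 1) := by
    rw [coeff_univMonic (by rw [Fintype.card_fin]; omega), hcard]
  have hmem : (-1 : MvPolynomial (Fin b) k) ^ ((i : ℕ) + 1) * esymm (Fin b) k ((i : ℕ) + 1) ∈
      symmetricSubalgebra (Fin b) k :=
    Subalgebra.mul_mem _ (Subalgebra.pow_mem _ (Subalgebra.neg_mem _ (Subalgebra.one_mem _)) _)
      (esymm_isSymmetric _ _ _)
  have heq : (⟨(univMonic (Fin b) k).coeff (b - 1 - (i : ℕ)), isSymmetric_coeff_univMonic _⟩ :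
      symmetricSubalgebra (Fin b) k) =
      ⟨(-1 : MvPolynomial (Fin b) k), (Subalgebra.neg_mem _ (Subalgebra.one_mem _))⟩ ^ ((i : ℕ) + 1) *
        ⟨esymm (Fin b) k ((i : ℕ) + 1), esymm_isSymmetric _ _ _⟩ := by
    ext; simp [hc]
  rw [heq, map_mul, map_pow, specialize_esymm, coeff_monicOf_of_lt]
  have h1 : specialize k a ⟨(-1 : MvPolynomial (Fin b) k), (Subalgebra.neg_mem _ (Subalgebra.one_mem _))⟩ = -1 := by
    have : (⟨(-1 : MvPolynomial (Fin b) k), (Subalgebra.neg_mem _ (Subalgebra.one_mem _))⟩ :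
        symmetricSubalgebra (Fin b) k) = -1 := by ext; simp
    rw [this, map_neg, map_one]
  rw [h1, ← mul_assoc, ← mul_pow, neg_one_mul, neg_neg, one_pow, one_mul]

/-- **Compatibility with change of the base ring** [Villamayor 2007, Def. 1.2 p0006 L67–L68 / 1.7 p0008 L10–L12
«compatible with change of base rings `R_b → S` within the class of algebras over `k`»]: for a `k`-algebra map
`φ : S → S'`, specializing at `φ ∘ a` is `φ` after specializing at `a`. [cite: Villamayor2007, 1.7] -/
theorem specialize_comp {S' : Type*} [CommRing S'] [Algebra k S'] (φ : S →ₐ[k] S') (a : Fin b → S) :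
    specialize k (φ ∘ a) = φ.comp (specialize k a) := by
  rw [specialize, specialize, ← AlgHom.comp_assoc]
  congr 1
  refine MvPolynomial.algHom_ext fun i => ?_
  simp

end Specialize

/-! ## §1.5 p0007 L65–L83 / Def. 1.42 (1.42.2), `r = 1`: the elimination algebra `R̄_f = ⊕ I_r W^r ⊂ S[W]` -/

section Elim

variable (k : Type v) [CommRing k] {S : Type w} [CommRing S] [Algebra k S] {b : ℕ}

/-- The degree-`r` GENERATORS of the elimination ideal [Villamayor 2007, §1.5 p0007 L65–L66]: «an homogenous
element `H` of degree, say `r`, in `R̄_b`, maps to an element, say `h`, in `S`, which is a polynomial expression on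
the coefficients `a_i` of `f(Z)`» — the images under `specialize a` of the degree-`r` piece `[R̄_b]_r`
(`univElimPiece`, via `R̄_b ⊆ R_b` = `univElimOne_le_symmetricSubalgebra`). [cite: Villamayor2007, §1.5 p0007 L65–L66] -/
def elimGen (a : Fin b → S) (r : ℕ) : Set S :=
  Set.range fun H : univElimPiece (Fin b) k (fun _ : Fin b => ()) r =>
    specialize k a ⟨(H : MvPolynomial (Fin b) k), univElimOne_le_symmetricSubalgebra H.2.1⟩

/-- **The elimination ideals `I_r`** [Villamayor 2007, §1.5 p0007 L78–L80]: «a direct sum of ideals in `S`, say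
`⊕_{r≥0} I_r W^r`. Now for each index `r`, the ideal `I_r` is generated by polynomials on the coefficients of
`f(Z)`»: `I_r := Ideal.span (elimGen a r)`. [cite: Villamayor2007, §1.5 p0007 L78–L80] -/
def elimIdeal (a : Fin b → S) (r : ℕ) : Ideal S :=
  Ideal.span (elimGen k a r)

/-- **The elimination algebra of a monic polynomial** [Villamayor 2007, §1.5 p0007 L70–L79; Def. 1.42 (1.42.2)
p0014 L37–L45 for `r = 1`]: «`R̄_b = k[H₁,…,H_s]` … by a change of the base ring `R̄_b → S`, the `S` subalgebra of
`S[W]` generated by `{h₁·W^{r₁},…,h_s·W^{r_s}}`, namely `S[h₁·W^{r₁},…,h_s·W^{r_s}]`. This is a Rees algebra, a direct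
sum of ideals in `S`, say `⊕_{r≥0} I_r W^r`» — typed as the graded subring of the family `(I_r)_r`
(`reesOfFamily`), generated by ALL `h W^{deg H}`, `H ∈ R̄_b` homogeneous (the same subalgebra as with a finite
homogeneous generating set). Its elements are read off degreewise by `mem_elimAlgebra_iff`. The variable is
Mathlib's `Polynomial.X` («`W`»). [cite: Villamayor2007, Def. 1.42] -/
def elimAlgebra (a : Fin b → S) : Subalgebra S S[X] :=
  reesOfFamily S (elimIdeal k a)

variable {k}

/-- Generators lie in their ideal. [cite: Villamayor2007, §1.5 p0007 L78–L80] -/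
theorem specialize_mem_elimIdeal (a : Fin b → S) {r : ℕ} {H : MvPolynomial (Fin b) k}
    (hH : H ∈ univElimPiece (Fin b) k (fun _ : Fin b => ()) r) :
    specialize k a ⟨H, univElimOne_le_symmetricSubalgebra hH.1⟩ ∈ elimIdeal k a r :=
  Ideal.subset_span ⟨⟨H, hH⟩, rfl⟩

/-- i) `I_0 = S` (the constant `1 ∈ [R̄_b]_0` specializes to `1`). [cite: Villamayor2007, §2.1 i)] -/
theorem elimIdeal_zero (a : Fin b → S) : elimIdeal k a 0 = ⊤ := by
  rw [eq_top_iff, ← Ideal.span_singleton_one, Ideal.span_le, Set.singleton_subset_iff]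
  have h := specialize_mem_elimIdeal a (one_mem_univElimPiece_zero (k := k) (fun _ : Fin b => ()))
  have h1 : (⟨(1 : MvPolynomial (Fin b) k), univElimOne_le_symmetricSubalgebra
      (one_mem_univElimPiece_zero (k := k) (fun _ : Fin b => ())).1⟩ : symmetricSubalgebra (Fin b) k) = 1 := rfl
  rw [h1, map_one] at h
  exact h

/-- ii) `I_m · I_n ⊆ I_{m+n}` (products of homogeneous invariants are homogeneous invariants of the summed degree,
`mul_mem_univElimPiece`). [cite: Villamayor2007, §2.1 ii)] -/
theorem elimIdeal_mul_le (a : Fin b → S) (m n : ℕ) :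
    elimIdeal k a m * elimIdeal k a n ≤ elimIdeal k a (m + n) := by
  rw [elimIdeal, elimIdeal, Ideal.span_mul_span']
  refine Ideal.span_le.mpr ?_
  rintro _ ⟨x, ⟨⟨H, hH⟩, rfl⟩, y, ⟨⟨H', hH'⟩, rfl⟩, rfl⟩
  have hmul := specialize_mem_elimIdeal a (mul_mem_univElimPiece hH hH')
  dsimp only
  rw [← map_mul]
  exact hmul

/-- **«A direct sum of ideals `⊕ I_r W^r`»** [Villamayor 2007, §1.5 p0007 L78–L79]: `q ∈ R̄_f` iff every
coefficient `coeff_r q ∈ I_r`. [cite: Villamayor2007, §1.5 p0007 L78–L79] -/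
theorem mem_elimAlgebra_iff (a : Fin b → S) {q : S[X]} :
    q ∈ elimAlgebra k a ↔ ∀ r, q.coeff r ∈ elimIdeal k a r :=
  mem_reesOfFamily_iff (elimIdeal_zero a) (elimIdeal_mul_le a)

/-- `h W^r ∈ R̄_f` for `h ∈ I_r`. [cite: Villamayor2007, §1.5 p0007 L73–L76] -/
theorem monomial_mem_elimAlgebra (a : Fin b → S) {r : ℕ} {h : S} (hh : h ∈ elimIdeal k a r) :
    Polynomial.monomial r h ∈ elimAlgebra k a :=
  monomial_mem_reesOfFamily hh

/-- **Functoriality in the base ring** (Def. 1.2 / 1.7 «compatible with change of base rings»): for a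
`k`-algebra map `φ : S → S'`, `I_r(φ ∘ a) = φ(I_r(a)) S'`. [cite: Villamayor2007, 1.7] -/
theorem elimIdeal_map {S' : Type w} [CommRing S'] [Algebra k S'] (φ : S →ₐ[k] S') (a : Fin b → S) (r : ℕ) :
    elimIdeal k (φ ∘ a) r = (elimIdeal k a r).map φ := by
  rw [elimIdeal, elimIdeal, Ideal.map_span]
  congr 1
  ext x
  simp only [elimGen, Set.mem_range, Set.mem_image, specialize_comp, AlgHom.comp_apply]
  constructor
  · rintro ⟨H, rfl⟩; exact ⟨_, ⟨H, rfl⟩, rfl⟩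
  · rintro ⟨_, ⟨H, rfl⟩, rfl⟩; exact ⟨H, rfl⟩

/-- The discriminant-type invariant specializes into `I_{b(b−1)}`: the image of `∏_{i≠j}(Y_i − Y_j) ∈ [R̄_b]_{b(b−1)}`
lies in the elimination ideal of that degree (p0006 L22–L23 «the discriminant of `F(Z)` is an element of this
invariant ring»; `prod_sub_mem_univElimOne`). [cite: Villamayor2007, §1 p0006 L22–L23] -/
theorem specialize_prod_sub_mem_elimIdeal (a : Fin b → S) :
    specialize k a ⟨∏ ij ∈ (Finset.univ : Finset (Fin b × Fin b)).filter (fun ij => ij.1 ≠ ij.2),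
        (X ij.1 - X ij.2 : MvPolynomial (Fin b) k),
        univElimOne_le_symmetricSubalgebra prod_sub_mem_univElimOne⟩ ∈
      elimIdeal k a ((Finset.univ : Finset (Fin b × Fin b)).filter (fun ij => ij.1 ≠ ij.2)).card := by
  refine specialize_mem_elimIdeal a ⟨prod_sub_mem_univElimOne, ?_⟩
  show MvPolynomial.IsHomogeneous _ _
  rw [Finset.card_eq_sum_ones]
  exact IsHomogeneous.prod _ _ _ fun (ij : Fin b × Fin b) _ =>
    (isHomogeneous_X k ij.1).sub (isHomogeneous_X k ij.2)

end Elim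

/-! ## Def. 4.10 (the `r = 1` sub-family): elimination algebra generated by one-polynomial choices -/

section Family

variable (k : Type v) [CommRing k] {S : Type w} [CommRing S] [Algebra k S]

/-- The coefficient vector of a monic polynomial of degree `c`: `a i := coeff_{c−1−i} f` (so `f = monicOf a` when
`f` is monic of degree `c`, `monicOf_coeffVec`). [cite: Villamayor2007, §1.5] -/
def coeffVec (c : ℕ) (f : S[X]) : Fin c → S := fun i => f.coeff (c - 1 - (i : ℕ))

/-- **Def. 4.10, `r = 1` sub-family** [Villamayor 2007, Def. 4.10 p0022 L46–L71]: «The elimination algebra, say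
`R_𝒢`, is defined as the smallest subalgebra of `S[W]`, containing all (elimination) algebras
`R̄_{f_{c₁},f_{c₂},…,f_{c_r}}`, for all choices of `r`, and of elements `f_{c_i}(Z) ∈ I_{(c_i)}` monic of degree `c_i`
in `S[Z]`» (`I_{(c)} = I_c ∩ S[Z]`, §4.3 p0020 L24–L27). TYPED HERE: the subalgebra of `S[W]` generated by the
ONE-polynomial algebras `R̄_f` (`elimAlgebra`) over all `c` and all `f ∈ I_{(c)}` monic of degree `c`, for a family
`I : ℕ → Ideal S[Z]` of contracted pieces. Since `R̄_{f_{c₁},…,f_{c_r}} ⊇ R̄_{f_{c_i}}` (p0022 L64–L66), this is a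
subalgebra of the printed `R_𝒢`; equality is NOT claimed and `R_𝒢` is not typed.
-- TODO(general form): the `r ≥ 2` members `R̄_{f_{c₁},…,f_{c_r}}` need the Young-subgroup specialization
-- `k[Y]^{𝕊_{c₁}×⋯×𝕊_{c_r}} → S` (no fundamental theorem for it in Mathlib); universal side = `univElim blk`.
Both `S[Z]` and `S[W]` are Mathlib's `Polynomial S`; the input family lives in the `Z`-copy, the output in the
`W`-copy. Transversality of the projection and the Diff-algebra hypothesis of Def. 4.10 are NOT encoded (hypotheses
of Thm. 4.11, not data). [cite: Villamayor2007, Def. 4.10] -/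
def elimAlgebraOneGen (I : ℕ → Ideal S[X]) : Subalgebra S S[X] :=
  ⨆ (c : ℕ), ⨆ (f : {f : S[X] // f ∈ I c ∧ f.Monic ∧ f.natDegree = c}), elimAlgebra k (coeffVec c f.1)

variable {k}

/-- Each one-polynomial elimination algebra `R̄_f`, `f ∈ I_{(c)}` monic of degree `c`, is contained in
`elimAlgebraOneGen I` (p0022 L52–L56). [cite: Villamayor2007, Def. 4.10] -/
theorem elimAlgebra_le_elimAlgebraOneGen (I : ℕ → Ideal S[X]) {c : ℕ} {f : S[X]} (hf : f ∈ I c)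
    (hmonic : f.Monic) (hdeg : f.natDegree = c) :
    elimAlgebra k (coeffVec c f) ≤ elimAlgebraOneGen k I :=
  le_iSup₂_of_le (f := fun c (f : {f : S[X] // f ∈ I c ∧ f.Monic ∧ f.natDegree = c}) =>
    elimAlgebra k (coeffVec c f.1)) c ⟨f, hf, hmonic, hdeg⟩ le_rfl

/-- A monic polynomial of degree `c` IS `monicOf` of its coefficient vector. [cite: Villamayor2007, §1.5] -/
theorem monicOf_coeffVec {c : ℕ} {f : S[X]} (hmonic : f.Monic) (hdeg : f.natDegree = c) :
    monicOf (coeffVec c f) = f := by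
  classical
  ext n
  by_cases hn : n < c
  · -- `n = c - 1 - i` with `i = c - 1 - n`
    have hi : c - 1 - n < c := by omega
    have h := coeff_monicOf_of_lt (coeffVec c f) ⟨c - 1 - n, hi⟩
    simp only at h
    have hcn : c - 1 - (c - 1 - n) = n := by omega
    rw [hcn] at h
    rw [h, coeffVec]
    simp only [hcn]
  · rcases Nat.eq_or_lt_of_le (Nat.not_lt.mp hn) with h | h
    · subst h
      rw [coeff_monicOf_self, ← hdeg]
      exact hmonic.coeff_natDegree.symm
    · have hf0 : f.coeff n = 0 := Polynomial.coeff_eq_zero_of_natDegree_lt (by omega)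
      rw [hf0, monicOf, Polynomial.coeff_add, Polynomial.coeff_X_pow, if_neg (by omega), zero_add,
        Polynomial.finsetSum_coeff]
      refine Finset.sum_eq_zero fun j _ => ?_
      rw [Polynomial.coeff_C_mul, Polynomial.coeff_X_pow, if_neg, mul_zero]
      have := j.2; omega

end Family

end Literature.AlgebraicGeometry.Villamayor2007

end
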